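import Literature.Computability.AlgebraicComplexity.MignonRessayreBound
import Mathlib.Analysis.Complex.Basic

/-!
# `DetqpThesis` (stmt-ValiantsHypothesis-0315), line `Sketch` (idea four-dimensional-determinant) —
# stub T2 `stub_hdPattern_mulVec_injective`: the hyperdeterminantal Hessian pattern is non-degenerate

The Hessian of the generic four-dimensional Cayley hyperdeterminant `HD_{m+3}` at the diagonal
block embedding of the Mignon–Ressayre point `y₀` is, up to the nonzero factor `(m+3)! · m!`, the
pattern matrix on `Fin 4 → Fin (m+3)`

  `P[I, J] = ε(I, J) · mrHess (I 0, I 1) (J 0, J 1)`,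

where `mrHess` is the Hessian pattern of `per_{m+3}` at `y₀` (`HessianAtOrigin.lean`, Landsberg
2017, (6.4.3)) and `ε(I, J) = ε₂ ε₃ ∈ {0, ±1}` with `ε₂ = +1` if `I 2 = I 0 ∧ J 2 = J 0`,
`ε₂ = -1` if `I 2 = J 0 ∧ J 2 = I 0`, `ε₂ = 0` otherwise (likewise `ε₃` on slots `3 / 1`).  This
file proves that `P` has injective `mulVec` over any field of characteristic `0`
(`stub_hdPattern_mulVec_injective` over `ℂ`), whence the milestone `n⁴ ≤ 2 · dc(HD_n)` of the
line (assembled by the lead).  The matrix is written inline through a local notation `hdP` (helpers in the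
sub-namespace `HdPattern`); no definition is introduced.

Proof.  Classify an index `K` by its type: slot `2` diagonal (`K 2 = K 0`) or not, slot `3`
diagonal (`K 3 = K 1`) or not.  In a row `I` the factor `ε` reads (`hdP_apply_dd/do/od/oo`)
`[J 2 = J 0]` resp. `-[J 0 = I 2 ∧ J 2 = I 0]` on slot `2` according as `I 2 = I 0` or not, and
similarly on slot `3`; so `P` is block diagonal with respect to the four types and
* (off/off) row `I` meets only the column `(I 2, I 3, I 0, I 1)`, with coefficient
  `mrHess (I 0, I 1) (I 2, I 3) ∈ {m + 1, -2}`, nonzero (`hdP_mulVec_oo`, `mrHess_ne_zero`);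
* (diag/off) row `(a, b, a, d)`, `b ≠ d`, reads `-∑_{a'} mrHess (a, b) (a', d) v (a', d, a', b)`
  (`hdP_mulVec_do`), i.e. for fixed `(b, d)` the bordered system
  `∑_{a' ≠ a} h(a, a') w a' = 0`, `h = m + 1` if `0 ∈ {a, a', b, d}` and `-2` otherwise, which is
  Landsberg's block `Q = (m+1)(J-1)` or `R` (`eq_zero_of_mrQ`, `eq_zero_of_mrR` in tree;
  `eq_zero_of_mrQR`, `sum_mrHess_row`);
* (off/diag) symmetrically with rows and columns of the `(m+3) × (m+3)` indices exchanged
  (`hdP_mulVec_od`, `sum_mrHess_col`);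
* (diag/diag) rows `(a, b, a, b)` give `mrHess w = 0` for `w (a, b) = v (a, b, a, b)`
  (`hdP_mulVec_dd`), and `mrHess_mulVec_eq_zero_imp` (Landsberg 2017, Lemma 6.4.6.3, in tree).
Hence a kernel vector vanishes at every index (`hdP_mulVec_eq_zero_imp`).

References: J. M. Landsberg, *Geometry and Complexity Theory*, CUP 2017, §6.4.6 (Lemma 6.4.6.3,
(6.4.3)); T. Mignon, N. Ressayre, *A quadratic bound for the determinant and permanent problem*,
IMRN 2004, §3.  Not here: the covariance identity computing the Hessian of `HD_n` at the block
point (stubs T1a, T1b) and the assembly of the milestone.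
-/

noncomputable section

-- single-conjunct layout: Sub = Summit, duplicated namespace component intended
set_option linter.dupNamespace false

namespace Summit.ValiantsHypothesis.ValiantsHypothesis.Theorems.DetQPDetqpThesis

open Literature.Computability.AlgebraicComplexity MvPolynomial

namespace HdPattern

variable {k : Type*} [Field k] {m : ℕ}

/-- The pattern matrix `P = ε · mrHess` (local notation; the statement of the stub inlines it). -/
local notation3 "hdP" => (Matrix.of fun I J : Fin 4 → Fin (m + 3) =>
      (if ((I 2 = I 0 ∧ J 2 = J 0) ∨ (I 2 = J 0 ∧ J 2 = I 0)) ∧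
          ((I 3 = I 1 ∧ J 3 = J 1) ∨ (I 3 = J 1 ∧ J 3 = I 1))
        then (if I 2 = I 0 then (1 : k) else -1) * (if I 3 = I 1 then 1 else -1) else 0) *
      mrHess k m (I 0, I 1) (J 0, J 1))

/-- A `4`-tuple is the vector of its entries. [folklore] -/
theorem vec4_eq (J : Fin 4 → Fin (m + 3)) {a b c d : Fin (m + 3)}
    (h0 : J 0 = a) (h1 : J 1 = b) (h2 : J 2 = c) (h3 : J 3 = d) : ![a, b, c, d] = J := by
  subst h0 h1 h2 h3
  funext i
  fin_cases i <;> rfl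

/-- Entries of the pattern matrix in a row of diagonal/diagonal type. [folklore] -/
theorem hdP_apply_dd {I : Fin 4 → Fin (m + 3)} (h2 : I 2 = I 0) (h3 : I 3 = I 1)
    (J : Fin 4 → Fin (m + 3)) :
    (hdP : Matrix _ _ k) I J =
      if J 2 = J 0 ∧ J 3 = J 1 then mrHess k m (I 0, I 1) (J 0, J 1) else 0 := by
  rw [Matrix.of_apply]
  split_ifs <;> grind

/-- Entries of the pattern matrix in a row of diagonal/off-diagonal type. [folklore] -/
theorem hdP_apply_do {I : Fin 4 → Fin (m + 3)} (h2 : I 2 = I 0) (h3 : I 3 ≠ I 1)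
    (J : Fin 4 → Fin (m + 3)) :
    (hdP : Matrix _ _ k) I J =
      if J 2 = J 0 ∧ J 1 = I 3 ∧ J 3 = I 1 then -mrHess k m (I 0, I 1) (J 0, J 1) else 0 := by
  rw [Matrix.of_apply]
  split_ifs <;> grind

/-- Entries of the pattern matrix in a row of off-diagonal/diagonal type. [folklore] -/
theorem hdP_apply_od {I : Fin 4 → Fin (m + 3)} (h2 : I 2 ≠ I 0) (h3 : I 3 = I 1)
    (J : Fin 4 → Fin (m + 3)) :
    (hdP : Matrix _ _ k) I J =
      if J 0 = I 2 ∧ J 2 = I 0 ∧ J 3 = J 1 then -mrHess k m (I 0, I 1) (J 0, J 1) else 0 := by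
  rw [Matrix.of_apply]
  split_ifs <;> grind

/-- Entries of the pattern matrix in a row of off-diagonal/off-diagonal type. [folklore] -/
theorem hdP_apply_oo {I : Fin 4 → Fin (m + 3)} (h2 : I 2 ≠ I 0) (h3 : I 3 ≠ I 1)
    (J : Fin 4 → Fin (m + 3)) :
    (hdP : Matrix _ _ k) I J =
      if J 0 = I 2 ∧ J 1 = I 3 ∧ J 2 = I 0 ∧ J 3 = I 1
      then mrHess k m (I 0, I 1) (J 0, J 1) else 0 := by
  rw [Matrix.of_apply]
  split_ifs <;> grind

/-- Row of off-diagonal/off-diagonal type `I`: the only column met is `(I 2, I 3, I 0, I 1)`.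
[folklore] -/
theorem hdP_mulVec_oo (v : (Fin 4 → Fin (m + 3)) → k) {I : Fin 4 → Fin (m + 3)}
    (h2 : I 2 ≠ I 0) (h3 : I 3 ≠ I 1) :
    ((hdP : Matrix _ _ k).mulVec v) I = mrHess k m (I 0, I 1) (I 2, I 3) * v ![I 2, I 3, I 0, I 1] := by
  change ∑ J, (hdP : Matrix _ _ k) I J * v J = _
  rw [Finset.sum_eq_single (![I 2, I 3, I 0, I 1] : Fin 4 → Fin (m + 3))]
  · rw [hdP_apply_oo h2 h3, if_pos (by simp)]
    simp
  · intro J _ hJ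
    rw [hdP_apply_oo h2 h3, if_neg, zero_mul]
    rintro ⟨e0, e1, e2, e3⟩
    exact hJ (vec4_eq J e0 e1 e2 e3).symm
  · exact fun h => absurd (Finset.mem_univ _) h

/-- Row of diagonal/off-diagonal type `I`: the columns met are `(a, I 3, a, I 1)`. [folklore] -/
theorem hdP_mulVec_do (v : (Fin 4 → Fin (m + 3)) → k) {I : Fin 4 → Fin (m + 3)}
    (h2 : I 2 = I 0) (h3 : I 3 ≠ I 1) :
    ((hdP : Matrix _ _ k).mulVec v) I =
      -∑ a, mrHess k m (I 0, I 1) (a, I 3) * v ![a, I 3, a, I 1] := by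
  change ∑ J, (hdP : Matrix _ _ k) I J * v J = _
  rw [← Finset.sum_neg_distrib]
  symm
  refine Fintype.sum_of_injective
    (fun a : Fin (m + 3) => (![a, I 3, a, I 1] : Fin 4 → Fin (m + 3))) ?_ _ _ ?_ ?_
  · intro a a' h
    simpa using congrFun h 0
  · intro J hJ
    rw [hdP_apply_do h2 h3, if_neg, zero_mul]
    rintro ⟨e2, e1, e3⟩
    exact hJ ⟨J 0, vec4_eq J rfl e1 e2 e3⟩
  · intro a
    rw [hdP_apply_do h2 h3, if_pos (by simp)]
    simp

/-- Row of off-diagonal/diagonal type `I`: the columns met are `(I 2, b, I 0, b)`. [folklore] -/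
theorem hdP_mulVec_od (v : (Fin 4 → Fin (m + 3)) → k) {I : Fin 4 → Fin (m + 3)}
    (h2 : I 2 ≠ I 0) (h3 : I 3 = I 1) :
    ((hdP : Matrix _ _ k).mulVec v) I =
      -∑ b, mrHess k m (I 0, I 1) (I 2, b) * v ![I 2, b, I 0, b] := by
  change ∑ J, (hdP : Matrix _ _ k) I J * v J = _
  rw [← Finset.sum_neg_distrib]
  symm
  refine Fintype.sum_of_injective
    (fun b : Fin (m + 3) => (![I 2, b, I 0, b] : Fin 4 → Fin (m + 3))) ?_ _ _ ?_ ?_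
  · intro b b' h
    simpa using congrFun h 1
  · intro J hJ
    rw [hdP_apply_od h2 h3, if_neg, zero_mul]
    rintro ⟨e0, e2, e3⟩
    exact hJ ⟨J 1, vec4_eq J e0 rfl e2 e3⟩
  · intro b
    rw [hdP_apply_od h2 h3, if_pos (by simp)]
    simp

/-- Row of diagonal/diagonal type `I`: the columns met are the `(a, b, a, b)`, with the entries
of `mrHess`. [folklore] -/
theorem hdP_mulVec_dd (v : (Fin 4 → Fin (m + 3)) → k) {I : Fin 4 → Fin (m + 3)}
    (h2 : I 2 = I 0) (h3 : I 3 = I 1) :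
    ((hdP : Matrix _ _ k).mulVec v) I =
      ((mrHess k m).mulVec fun s => v ![s.1, s.2, s.1, s.2]) (I 0, I 1) := by
  change ∑ J, (hdP : Matrix _ _ k) I J * v J = ∑ s, mrHess k m (I 0, I 1) s * v ![s.1, s.2, s.1, s.2]
  symm
  refine Fintype.sum_of_injective
    (fun s : Fin (m + 3) × Fin (m + 3) => (![s.1, s.2, s.1, s.2] : Fin 4 → Fin (m + 3))) ?_ _ _ ?_ ?_
  · intro s t h
    exact Prod.ext (by simpa using congrFun h 0) (by simpa using congrFun h 1)
  · intro J hJ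
    rw [hdP_apply_dd h2 h3, if_neg, zero_mul]
    rintro ⟨e2, e3⟩
    exact hJ ⟨(J 0, J 1), vec4_eq J rfl rfl e2 e3⟩
  · intro s
    rw [hdP_apply_dd h2 h3, if_pos (by simp)]
    simp

/-- A row sum `∑_{a'} mrHess (a, b) (a', d) w a'` with `d ≠ b` is the bordered sum of
`eq_zero_of_mrQR` over `a' ≠ a`. [folklore] -/
theorem sum_mrHess_row (w : Fin (m + 3) → k) (a b d : Fin (m + 3)) (hbd : d ≠ b) :
    ∑ a', mrHess k m (a, b) (a', d) * w a' = ∑ a' ∈ Finset.univ.erase a,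
      (if a = 0 ∨ a' = 0 ∨ (b = 0 ∨ d = 0) then ((m : k) + 1) else -2) * w a' := by
  rw [← Finset.sum_erase (Finset.univ) (a := a)
    (by rw [mrHess_apply, if_pos (Or.inl rfl), zero_mul])]
  refine Finset.sum_congr rfl fun a' ha' => ?_
  rw [mrHess_apply, if_neg (not_or.mpr ⟨(Finset.mem_erase.mp ha').1, hbd⟩)]
  congr 1
  exact if_congr (by tauto) rfl rfl

/-- A column sum `∑_{b'} mrHess (a, b) (c, b') u b'` with `c ≠ a` is the bordered sum of
`eq_zero_of_mrQR` over `b' ≠ b`. [folklore] -/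
theorem sum_mrHess_col (u : Fin (m + 3) → k) (a b c : Fin (m + 3)) (hac : c ≠ a) :
    ∑ b', mrHess k m (a, b) (c, b') * u b' = ∑ b' ∈ Finset.univ.erase b,
      (if b = 0 ∨ b' = 0 ∨ (a = 0 ∨ c = 0) then ((m : k) + 1) else -2) * u b' := by
  rw [← Finset.sum_erase (Finset.univ) (a := b)
    (by rw [mrHess_apply, if_pos (Or.inr rfl), zero_mul])]
  refine Finset.sum_congr rfl fun b' hb' => ?_
  rw [mrHess_apply, if_neg (not_or.mpr ⟨hac, (Finset.mem_erase.mp hb').1⟩)]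
  congr 1
  exact if_congr (by tauto) rfl rfl

section Kernel

variable [CharZero k]

/-- The bordered `(m+3) × (m+3)` systems met in the mixed-type rows have trivial kernel: if
`∑_{a' ≠ a} h(a, a') w a' = 0` for every `a`, where `h(a, a') = m + 1` if `a = 0 ∨ a' = 0 ∨ Q` and
`-2` otherwise, then `w = 0` (`Q` true: the block `Q = (m+1)(J-1)`, `eq_zero_of_mrQ`; `Q` false:
the bordered block `R`, `eq_zero_of_mrR`; Landsberg 2017, Lemma 6.4.6.3). [folklore] -/
theorem eq_zero_of_mrQR (Q : Prop) [Decidable Q] (w : Fin (m + 3) → k)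
    (hw : ∀ a, ∑ a' ∈ Finset.univ.erase a,
      (if a = 0 ∨ a' = 0 ∨ Q then ((m : k) + 1) else -2) * w a' = 0) : w = 0 := by
  by_cases hQ : Q
  · refine eq_zero_of_mrQ w fun a => ?_
    rw [Finset.mul_sum, ← hw a]
    exact Finset.sum_congr rfl fun a' _ => by rw [if_pos (Or.inr (Or.inr hQ))]
  · refine eq_zero_of_mrR w fun a => ?_
    rw [← hw a]
    exact Finset.sum_congr rfl fun a' _ => by simp only [hQ, or_false]

/-- The entries of `mrHess` are nonzero off the excluded row and column (characteristic `0`).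
[folklore] -/
theorem mrHess_ne_zero {a b c d : Fin (m + 3)} (hac : c ≠ a) (hbd : d ≠ b) :
    mrHess k m (a, b) (c, d) ≠ 0 := by
  have hm1 : ((m : k) + 1) ≠ 0 := by exact_mod_cast (Nat.succ_ne_zero _ : m + 1 ≠ 0)
  rw [mrHess_apply, if_neg (not_or.mpr ⟨hac, hbd⟩)]
  split_ifs
  · exact hm1
  · exact neg_ne_zero.mpr two_ne_zero

/-- **The hyperdeterminantal Hessian pattern has trivial kernel** (characteristic `0`): a vector
`v` with `hdP v = 0` vanishes, type by type of its index `K` (slots `2, 3` diagonal or not).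
[folklore] -/
theorem hdP_mulVec_eq_zero_imp (v : (Fin 4 → Fin (m + 3)) → k)
    (hv : (hdP : Matrix _ _ k).mulVec v = 0) : v = 0 := by
  have hrow : ∀ I, ((hdP : Matrix _ _ k).mulVec v) I = 0 := fun I => by rw [hv]; rfl
  funext K
  by_cases hK2 : K 2 = K 0 <;> by_cases hK3 : K 3 = K 1
  · -- diagonal/diagonal: `w (a, b) := v (a, b, a, b)` satisfies `mrHess w = 0`
    have hw : (mrHess k m).mulVec (fun s => v ![s.1, s.2, s.1, s.2]) = 0 := by
      funext s
      have h := hrow ![s.1, s.2, s.1, s.2]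
      rw [hdP_mulVec_dd v (by simp) (by simp)] at h
      simpa using h
    have h := congrFun (mrHess_mulVec_eq_zero_imp _ hw) (K 0, K 1)
    simp only [Pi.zero_apply] at h
    rw [vec4_eq K rfl rfl hK2 hK3] at h
    exact h
  · -- diagonal/off-diagonal: `w a := v (a, K 1, a, K 3)`, rows `(a, K 3, a, K 1)`
    have hw : (fun a => v ![a, K 1, a, K 3]) = 0 := by
      refine eq_zero_of_mrQR (K 3 = 0 ∨ K 1 = 0) _ fun a => ?_
      have h := hrow ![a, K 3, a, K 1]
      rw [hdP_mulVec_do v (by simp) (by simpa using fun h' => hK3 h'.symm), neg_eq_zero] at h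
      simp only [Matrix.cons_val_zero, Matrix.cons_val_one, Matrix.cons_val] at h
      rwa [sum_mrHess_row _ _ _ _ (fun h' => hK3 h'.symm)] at h
    have h := congrFun hw (K 0)
    simp only [Pi.zero_apply] at h
    rw [vec4_eq K rfl rfl hK2 rfl] at h
    exact h
  · -- off-diagonal/diagonal: `u b := v (K 0, b, K 2, b)`, rows `(K 2, b, K 0, b)`
    have hu : (fun b => v ![K 0, b, K 2, b]) = 0 := by
      refine eq_zero_of_mrQR (K 2 = 0 ∨ K 0 = 0) _ fun b => ?_
      have h := hrow ![K 2, b, K 0, b]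
      rw [hdP_mulVec_od v (by simpa using fun h' => hK2 h'.symm) (by simp), neg_eq_zero] at h
      simp only [Matrix.cons_val_zero, Matrix.cons_val_one, Matrix.cons_val] at h
      rwa [sum_mrHess_col _ _ _ _ (fun h' => hK2 h'.symm)] at h
    have h := congrFun hu (K 1)
    simp only [Pi.zero_apply] at h
    rw [vec4_eq K rfl rfl rfl hK3] at h
    exact h
  · -- off-diagonal/off-diagonal: the row `(K 2, K 3, K 0, K 1)` meets only the column `K`
    have h := hrow ![K 2, K 3, K 0, K 1]
    rw [hdP_mulVec_oo v (by simpa using fun h' => hK2 h'.symm)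
      (by simpa using fun h' => hK3 h'.symm)] at h
    simp only [Matrix.cons_val_zero, Matrix.cons_val_one, Matrix.cons_val] at h
    rw [vec4_eq K rfl rfl rfl rfl] at h
    exact (mul_eq_zero.mp h).resolve_left (mrHess_ne_zero (fun h' => hK2 h'.symm)
      (fun h' => hK3 h'.symm))

/-- **Injectivity of the hyperdeterminantal Hessian pattern** over any field of characteristic
`0`. [folklore] -/
theorem hdP_mulVec_injective : Function.Injective (hdP : Matrix _ _ k).mulVec := by
  intro v w h
  rw [← sub_eq_zero]
  apply hdP_mulVec_eq_zero_imp
  rw [Matrix.mulVec_sub, h, sub_self]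

end Kernel

end HdPattern

/-- **T2 — the hyperdeterminantal Hessian pattern is non-degenerate.**  The matrix
`P[I, J] = ε(I, J) · mrHess (I 0, I 1) (J 0, J 1)` on `Fin 4 → Fin (m+3)` — up to the factor
`(m+3)! · m!`, the Hessian of the generic four-dimensional hyperdeterminant `HD_{m+3}` at the
block-embedded Mignon–Ressayre point — has injective `mulVec` over `ℂ`.  Here `ε(I, J) = ε₂ ε₃`,
`ε₂ = +1` if `I 2 = I 0 ∧ J 2 = J 0`, `ε₂ = -1` if `I 2 = J 0 ∧ J 2 = I 0`, `ε₂ = 0` otherwise, and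
likewise `ε₃` on slots `3 / 1`. [folklore] -/
theorem stub_hdPattern_mulVec_injective (m : ℕ) :
    Function.Injective (Matrix.of fun I J : Fin 4 → Fin (m + 3) =>
      (if ((I 2 = I 0 ∧ J 2 = J 0) ∨ (I 2 = J 0 ∧ J 2 = I 0)) ∧
          ((I 3 = I 1 ∧ J 3 = J 1) ∨ (I 3 = J 1 ∧ J 3 = I 1))
        then (if I 2 = I 0 then (1 : ℂ) else -1) * (if I 3 = I 1 then 1 else -1) else 0) *
      mrHess ℂ m (I 0, I 1) (J 0, J 1)).mulVec :=
  HdPattern.hdP_mulVec_injective (k := ℂ) (m := m)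

end Summit.ValiantsHypothesis.ValiantsHypothesis.Theorems.DetQPDetqpThesis
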